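import Summits.CriticalPhenomena.PercolationContinuityZ3.Theorems.Transplant.CayleyMilnorKernel
import Literature.Probability.Percolation.CoveringQuotientMap
import HarnessLib

/-!
# Milnor's kernel lemma, IV: the CHART-FREE form of INPUT(G) for vertex-transitive graphs — a transitive group of automorphisms with finite
# vertex stabilisers and first Betti number `≥ 2` (modulo the one-type scaled node ALONE)

builds on p205010 (kernel theorem, internal audit signed; external expert review pending) — nothing in this file uses p205010.  The percolation
theorem is CONDITIONAL on the OPEN node `SamePDropOfSkeletonFrmScaled₁` (hypothesis `hN`; nothing is claimed about it) and on NOTHING ELSE.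
Lane `prim-bschramm`, seat `prim-bschramm-p4` gen 17 (PART C3 of `P4-GENERAL.md` §39).  Helper file (`--supports stmt-CriticalPhenomena-4575`).

THE STATEMENT.  `G` connected, locally finite; a group `A` acting on `V(G)` by graph automorphisms (`IsActionByAut`), TRANSITIVELY, with FINITE
stabiliser of a vertex `t`; a homomorphism `c : A → ℤ²` of rank-2 image.  Then `θ_v(p_c(G)) = 0` at every vertex, modulo the scaled node
(`AutScaled.criticalContinuity`).  No chart is part of the input: the chart is `v ↦ ψ(a)` for any `a` with `a • t = v` (well defined because `ψ`
kills the finite stabiliser), where `ψ` is the max-area re-basing of `c` over the finite set `S_A = {a | a • t ∈ N[t]}` (which generates `A`,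
`closure_genSet`).  Free actions are the Cayley case (`CayleyScaled.criticalContinuity_of_rank`); this file removes freeness.
THE PROOF.  `|B_{Cay(A;S_A)}(n)| ≤ |Stab(t)|·|B_G(t,n)|` (orbit map, `card_ball_le`), so exponential growth of `Cay(A; S_A)` passes to `G` and Hutchcroft
applies (`hasExponentialGrowth_of_cayley`); otherwise Milnor's lemma (file II) makes `ker c` finitely generated, `CayleyScaled.ofKerFG` gives the datum
`C` on `(A, S_A)`, and `G` carries the ONE-TYPE scaled skeleton `skeleton`: chart `ψ ∘ sec`, `L = N = C.N`, frames `a • ·`, exact `N`-steps `a ↦ a·tᵢ`,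
and (κ′) as the IMAGE of `C`'s connected Cayley cylinders under the orbit map (`cyl_connected`).  Then `continuity_of_frmScaledNode₁_ray`.
[cite: MilnorSolvableGrowth1968, Lemma 1 pp. 447–448] [cite: Hutchcroft2016, Thm. 1.1] [cite: BenjaminiSchramm1996, Conj. 4; §2 (almost transitive graphs)]
-/

noncomputable section

namespace Summit.CriticalPhenomena.PercolationContinuityZ3.Theorems.Transplant

open SimpleGraph Filter Literature.Barriers.CriticalPhenomena Literature.Probability.LatticeModels Literature.Probability.Percolation
open scoped Classical

namespace AutScaled

variable {V : Type} {G : SimpleGraph V} [G.LocallyFinite] {A : Type} [Group A] [MulAction A V]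

/-! ## §1 The finite generating set `S_A = {a | a • t ∈ N[t]}` -/

/-- `{a | a • t = w}` is finite when the stabiliser of `t` is (a coset of it, or empty). [folklore] -/
theorem finite_movers (t w : V) (hfin : (MulAction.stabilizer A t : Set A).Finite) : {a : A | a • t = w}.Finite := by
  by_cases hw : ∃ a₀ : A, a₀ • t = w
  · obtain ⟨a₀, rfl⟩ := hw
    refine (hfin.image fun σ => a₀ * σ).subset fun a ha => ⟨a₀⁻¹ * a, ?_, by group⟩
    show a₀⁻¹ * a ∈ MulAction.stabilizer A t
    rw [MulAction.mem_stabilizer_iff, mul_smul, show a • t = a₀ • t from ha, inv_smul_smul]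
  · rw [show {a : A | a • t = w} = ∅ from Set.eq_empty_of_forall_notMem fun a ha => hw ⟨a, ha⟩]
    exact Set.finite_empty

/-- `S_A = {a | a • t = t ∨ t ∼ a • t}` is finite (finitely many neighbours, finite stabiliser). [folklore] -/
theorem finite_genSet (t : V) (hfin : (MulAction.stabilizer A t : Set A).Finite) :
    {a : A | a • t = t ∨ G.Adj t (a • t)}.Finite := by
  refine ((((G.neighborSet t).toFinite.insert t).biUnion fun w _ => finite_movers t w hfin)).subset fun a ha => ?_
  rcases ha with h | h
  · exact Set.mem_biUnion (Set.mem_insert _ _) h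
  · exact Set.mem_biUnion (Set.mem_insert_of_mem _ h) rfl

/-- The generating set `S_A` as a `Finset`. [folklore] -/
def genSet (G : SimpleGraph V) [G.LocallyFinite] (t : V) (hfin : (MulAction.stabilizer A t : Set A).Finite) : Finset A :=
  (finite_genSet (G := G) t hfin).toFinset

/-- Membership in `S_A`. [folklore] -/
theorem mem_genSet {t : V} {hfin : (MulAction.stabilizer A t : Set A).Finite} {a : A} :
    a ∈ genSet G t hfin ↔ a • t = t ∨ G.Adj t (a • t) := by
  unfold genSet; rw [Set.Finite.mem_toFinset]; rfl

/-- **`S_A` generates `A`** (walk induction from `t`, transitivity, and `Stab(t) ⊆ S_A`). [cite: BenjaminiSchramm1996, §2 (almost transitive graphs)] -/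
theorem closure_genSet (hact : IsActionByAut G A) (hc : G.Connected) {t : V} (htr : ∀ v : V, ∃ a : A, a • t = v)
    (hfin : (MulAction.stabilizer A t : Set A).Finite) : Subgroup.closure (↑(genSet G t hfin) : Set A) = ⊤ := by
  set H := Subgroup.closure (↑(genSet G t hfin) : Set A) with hH
  have key : ∀ (x y : V) (p : G.Walk x y), y = t → ∃ b ∈ H, b • t = x := by
    intro x y p
    induction p with
    | nil => intro hy; exact ⟨1, one_mem _, by rw [one_smul]; exact hy.symm⟩
    | @cons x z y hxz p ih =>
      intro hy
      obtain ⟨b, hb, hbz⟩ := ih hy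
      obtain ⟨a, ha⟩ := htr (b⁻¹ • x)
      have hadj : G.Adj t (a • t) := by
        rw [ha]
        have h1 : G.Adj (b⁻¹ • x) (b⁻¹ • z) := (hact b⁻¹ x z).2 hxz
        rw [← hbz, inv_smul_smul] at h1
        exact h1.symm
      refine ⟨b * a, mul_mem hb (Subgroup.subset_closure (Finset.mem_coe.2 (mem_genSet.2 (Or.inr hadj)))), ?_⟩
      rw [mul_smul, ha, smul_inv_smul]
  refine (Subgroup.eq_top_iff' H).2 fun a₀ => ?_
  obtain ⟨p⟩ := hc.preconnected (a₀ • t) t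
  obtain ⟨b, hb, hbt⟩ := key _ _ p rfl
  have hσ : b⁻¹ * a₀ ∈ genSet G t hfin := by
    refine mem_genSet.2 (Or.inl ?_)
    rw [mul_smul, ← hbt, inv_smul_smul]
  have e : a₀ = b * (b⁻¹ * a₀) := by group
  rw [e]
  exact mul_mem hb (Subgroup.subset_closure (Finset.mem_coe.2 hσ))

/-! ## §2 The orbit map `a ↦ a • t` is a contraction `Cay(A; S_A) → G` with fibres of size `|Stab(t)|` -/

/-- An `S_A`-edge of `Cay(A; S_A)` maps to an edge or a non-move of `G`. [folklore] -/
theorem smul_adj_or_eq (hact : IsActionByAut G A) {t : V} {hfin : (MulAction.stabilizer A t : Set A).Finite} {a b : A}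
    (h : (mulCayley (↑(genSet G t hfin) : Set A)).Adj a b) : a • t = b • t ∨ G.Adj (a • t) (b • t) := by
  rw [mulCayley_adj] at h
  obtain ⟨-, h | h⟩ := h
  · rcases mem_genSet.1 (Finset.mem_coe.1 h) with h1 | h1
    · left; rw [mul_smul, inv_smul_eq_iff] at h1; exact h1.symm
    · right; rw [mul_smul, ← hact a, smul_inv_smul] at h1; exact h1
  · rcases mem_genSet.1 (Finset.mem_coe.1 h) with h1 | h1
    · left; rw [mul_smul, inv_smul_eq_iff] at h1; exact h1
    · right; rw [mul_smul, ← hact b, smul_inv_smul] at h1; exact h1.symm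

/-- **Walks descend**: a walk `a ⇝ b` in `Cay(A; S_A)` gives a walk `a • t ⇝ b • t` in `G` of at most the same length. [folklore] -/
theorem exists_walk_smul (hact : IsActionByAut G A) {t : V} {hfin : (MulAction.stabilizer A t : Set A).Finite} :
    ∀ {a b : A} (p : (mulCayley (↑(genSet G t hfin) : Set A)).Walk a b), ∃ q : G.Walk (a • t) (b • t), q.length ≤ p.length
  | _, _, Walk.nil => ⟨Walk.nil, le_rfl⟩
  | _, _, Walk.cons h p => by
    obtain ⟨q, hq⟩ := exists_walk_smul hact p
    rcases smul_adj_or_eq hact h with e | hadj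
    · exact ⟨q.copy e.symm rfl, by rw [Walk.length_copy, Walk.length_cons]; omega⟩
    · exact ⟨Walk.cons hadj q, by rw [Walk.length_cons, Walk.length_cons]; omega⟩

/-- **`|B_{Cay(A;S_A)}(1, n)| ≤ |Stab(t)| · |B_G(t, n)|`.** [folklore] -/
theorem card_ball_le (hact : IsActionByAut G A) {t : V} (hfin : (MulAction.stabilizer A t : Set A).Finite) (n : ℕ) :
    ballVolume (mulCayley (↑(genSet G t hfin) : Set A)) 1 n ≤ hfin.toFinset.card * ballVolume G t n := by
  set B := (graphBall_finite (mulCayley (↑(genSet G t hfin) : Set A)) 1 n).toFinset with hB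
  have hvol : ballVolume (mulCayley (↑(genSet G t hfin) : Set A)) 1 n = B.card := by
    rw [ballVolume, Set.ncard_eq_toFinset_card _ (graphBall_finite _ 1 n)]
  have himg : B.image (fun a : A => a • t) ⊆ (graphBall_finite G t n).toFinset := by
    intro v hv
    obtain ⟨a, ha, rfl⟩ := Finset.mem_image.1 hv
    obtain ⟨p, hp⟩ := (Set.Finite.mem_toFinset _).1 ha
    obtain ⟨q, hq⟩ := exists_walk_smul hact p
    exact (Set.Finite.mem_toFinset _).2 ⟨q.copy (one_smul A t) rfl, by rw [Walk.length_copy]; exact hq.trans hp⟩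
  have hfib : ∀ v ∈ B.image (fun a : A => a • t), (B.filter fun a => a • t = v).card ≤ hfin.toFinset.card := by
    intro v hv
    obtain ⟨a₀, -, rfl⟩ := Finset.mem_image.1 hv
    refine Finset.card_le_card_of_injOn (fun a => a₀⁻¹ * a) ?_ ?_
    · intro a ha
      have ha' : a • t = a₀ • t := (Finset.mem_filter.1 ha).2
      rw [Finset.mem_coe, Set.Finite.mem_toFinset]
      show a₀⁻¹ * a ∈ MulAction.stabilizer A t
      rw [MulAction.mem_stabilizer_iff, mul_smul, ha', inv_smul_smul]
    · intro a _ b _ h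
      exact mul_left_cancel h
  calc ballVolume (mulCayley (↑(genSet G t hfin) : Set A)) 1 n = B.card := hvol
    _ ≤ hfin.toFinset.card * (B.image fun a : A => a • t).card := Finset.card_le_mul_card_image B _ hfib
    _ ≤ hfin.toFinset.card * ballVolume G t n := by
        refine Nat.mul_le_mul_left _ ?_
        rw [ballVolume, Set.ncard_eq_toFinset_card _ (graphBall_finite G t n)]
        exact Finset.card_le_card himg

/-- **Exponential growth of `Cay(A; S_A)` passes to `G`** (rate `√c`; other vertices by the automorphisms `a • ·`).
[cite: Hutchcroft2016, §1 (exponential growth)] -/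
theorem hasExponentialGrowth_of_cayley (hact : IsActionByAut G A) {t : V} (htr : ∀ v : V, ∃ a : A, a • t = v)
    (hfin : (MulAction.stabilizer A t : Set A).Finite) (hexp : HasExponentialGrowth (mulCayley (↑(genSet G t hfin) : Set A))) :
    HasExponentialGrowth G := by
  have ht : ∃ c : ℝ, 1 < c ∧ ∀ᶠ n : ℕ in atTop, c ^ n ≤ (ballVolume G t n : ℝ) := by
    obtain ⟨c, hc, hev⟩ := hexp 1
    set K : ℕ := hfin.toFinset.card with hK
    have hK1 : (1 : ℝ) ≤ K := by
      have : 1 ≤ K := Finset.card_pos.2 ⟨1, by rw [Set.Finite.mem_toFinset]; exact one_mem _⟩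
      exact_mod_cast this
    have hc1 : 1 < Real.sqrt c := (Real.lt_sqrt zero_le_one).2 (by simpa using hc)
    have hsq : Real.sqrt c ^ 2 = c := Real.sq_sqrt (by linarith)
    obtain ⟨N₁, hN₁⟩ := eventually_atTop.1 hev
    obtain ⟨N₂, hN₂⟩ : ∃ N₂ : ℕ, (K : ℝ) ≤ Real.sqrt c ^ N₂ := by
      obtain ⟨N₂, hN₂⟩ := (tendsto_pow_atTop_atTop_of_one_lt hc1).eventually_ge_atTop (K : ℝ) |>.exists
      exact ⟨N₂, hN₂⟩
    refine ⟨Real.sqrt c, hc1, eventually_atTop.2 ⟨N₁ + N₂, fun n hn => ?_⟩⟩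
    have h1 : c ^ n ≤ (K : ℝ) * ballVolume G t n := by
      have := hN₁ n (by omega)
      exact this.trans (by exact_mod_cast card_ball_le hact hfin n)
    have h2 : Real.sqrt c ^ n * Real.sqrt c ^ N₂ ≤ Real.sqrt c ^ n * Real.sqrt c ^ n := by
      rw [← pow_add, ← pow_add]
      exact pow_le_pow_right₀ hc1.le (by omega)
    have h3 : Real.sqrt c ^ n * Real.sqrt c ^ n = c ^ n := by rw [← pow_add, ← two_mul, pow_mul, hsq]
    have hpos : 0 < Real.sqrt c ^ n := pow_pos (by linarith) n
    nlinarith [mul_le_mul_of_nonneg_left hN₂ hpos.le]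
  intro v
  obtain ⟨a, rfl⟩ := htr v
  obtain ⟨c, hc, hev⟩ := ht
  refine ⟨c, hc, ?_⟩
  filter_upwards [hev] with n hn
  rwa [← smulIso_apply hact a t, ballVolume_map_eq]

/-! ## §3 Off exponential growth: the one-type scaled skeleton of `G` from the Cayley datum on `(A, S_A)` -/

section Skeleton

variable (hact : IsActionByAut G A) {t : V} (htr : ∀ v : V, ∃ a : A, a • t = v)
  {hfin : (MulAction.stabilizer A t : Set A).Finite} (C : CayleyScaled A (genSet G t hfin))

/-- A section of the orbit map: `sec v • t = v`. [folklore] -/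
def sec (htr : ∀ v : V, ∃ a : A, a • t = v) (v : V) : A := Classical.choose (htr v)

/-- `sec v • t = v`. [folklore] -/
theorem sec_smul (v : V) : sec htr v • t = v := Classical.choose_spec (htr v)

/-- `ψ(a^n) = n • ψ(a)`. [folklore] -/
theorem ψ_pow (a : A) : ∀ n : ℕ, C.ψ (a ^ n) = n • C.ψ a
  | 0 => by rw [pow_zero, C.ψ_one, zero_smul]
  | n + 1 => by rw [pow_succ, C.ψ_mul, ψ_pow a n, add_smul, one_smul]

/-- **The re-based chart kills the (finite) stabiliser**: `σ • t = t ⟹ ψ σ = 0` (an element of finite order has `n • ψ σ = 0` in the torsion-free `ℤ²`).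
[folklore] -/
theorem ψ_eq_zero_of_smul_eq {σ : A} (hσ : σ • t = t) : C.ψ σ = 0 := by
  haveI : Finite (MulAction.stabilizer A t) := hfin.to_subtype
  have hmem : σ ∈ MulAction.stabilizer A t := MulAction.mem_stabilizer_iff.2 hσ
  obtain ⟨n, hn, hpow⟩ := (isOfFinOrder_of_finite (⟨σ, hmem⟩ : MulAction.stabilizer A t)).exists_pow_eq_one
  have hpow' : σ ^ n = 1 := by
    have := congrArg Subtype.val hpow
    simpa using this
  have h := ψ_pow C σ n
  rw [hpow', C.ψ_one] at h
  funext i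
  have hi : (n : ℤ) * C.ψ σ i = 0 := by
    have := congrFun h i
    rw [Pi.smul_apply, nsmul_eq_mul] at this
    exact this.symm
  rcases mul_eq_zero.1 hi with h0 | h0
  · exact absurd (by exact_mod_cast h0 : n = 0) (by omega)
  · exact h0

/-- **The chart `φ v := ψ(sec v)` satisfies `ψ a = φ (a • t)`** for every `a`. [folklore] -/
theorem ψ_eq_chart (a : A) : C.ψ a = C.ψ (sec htr (a • t)) := by
  have h : (a⁻¹ * sec htr (a • t)) • t = t := by rw [mul_smul, sec_smul, inv_smul_smul]
  have h0 := ψ_eq_zero_of_smul_eq C h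
  rw [C.ψ_mul, C.ψ_inv] at h0
  exact neg_add_eq_zero.1 h0

/-- **The chart of `G`**: `φ v := ψ(sec v)`. [folklore] -/
def chart (v : V) : Site 2 := C.ψ (sec htr v)

/-- **Equivariance**: `φ(a • w) = ψ a + φ w`. [folklore] -/
theorem chart_smul (a : A) (w : V) : chart htr C (a • w) = C.ψ a + chart htr C w := by
  unfold chart
  have h := ψ_eq_chart htr C (a * sec htr w)
  rw [mul_smul, sec_smul] at h
  rw [← h, C.ψ_mul]

/-- `φ t = 0`. [folklore] -/
theorem chart_base : chart htr C t = 0 := by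
  unfold chart
  have h := ψ_eq_chart htr C 1
  rw [one_smul, C.ψ_one] at h
  exact h.symm

/-- `φ(a • t) = ψ a`. [folklore] -/
theorem chart_smul_base (a : A) : chart htr C (a • t) = C.ψ a := by
  rw [chart_smul, chart_base, add_zero]

/-- **The step generators act as genuine edges**: `t ∼ tᵢ • t` (a stabiliser element would have `ψ = 0 ≠ N eᵢ`). [folklore] -/
theorem adj_gen (i : Fin 2) : G.Adj t (C.gen' i • t) := by
  rcases mem_genSet.1 (C.gen'_mem i) with h | h
  · exfalso
    have h0 := ψ_eq_zero_of_smul_eq C h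
    have h1 := congrFun (C.ψ_gen' i) i
    rw [h0, Pi.zero_apply, Pi.single_eq_same] at h1
    have h2 := C.one_le_N
    omega
  · exact h

include hact in
/-- **(κ′) for `G`**: the cylinder `{φ − φ t ∈ Λ_ℓ}`, `ℓ ≥ ℓ₀`, is connected — the image of the connected Cayley cylinder of `C` under the orbit map.
[cite: KozmaNitzan2024, §4 p. 15 (boxes)] -/
theorem cyl_connected {ℓ : ℕ} (hℓ : C.ℓ₀ ≤ ℓ) : (G.induce {w | chart htr C w - chart htr C t ∈ box 2 ℓ}).Connected := by
  have hcay := C.cyl_connected_of_le hℓ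
  have hmem : ∀ a : A, a ∈ {a : A | C.ψ a - C.ψ 1 ∈ box 2 ℓ} → a • t ∈ {w | chart htr C w - chart htr C t ∈ box 2 ℓ} := by
    intro a ha
    show chart htr C (a • t) - chart htr C t ∈ box 2 ℓ
    rw [chart_smul_base, chart_base, sub_zero]
    have ha' : C.ψ a - C.ψ 1 ∈ box 2 ℓ := ha
    rwa [C.ψ_one, sub_zero] at ha'
  have key : ∀ (x y : {a : A | C.ψ a - C.ψ 1 ∈ box 2 ℓ})
      (p : ((mulCayley (↑(genSet G t hfin) : Set A)).induce {a : A | C.ψ a - C.ψ 1 ∈ box 2 ℓ}).Walk x y),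
      (G.induce {w | chart htr C w - chart htr C t ∈ box 2 ℓ}).Reachable ⟨x.1 • t, hmem _ x.2⟩ ⟨y.1 • t, hmem _ y.2⟩ := by
    intro x y p
    induction p with
    | nil => exact Reachable.refl _
    | @cons a b c hab p ih =>
      refine Reachable.trans ?_ ih
      rcases smul_adj_or_eq hact (induce_adj.1 hab) with e | hadj
      · rw [show (⟨a.1 • t, hmem _ a.2⟩ : {w | chart htr C w - chart htr C t ∈ box 2 ℓ}) = ⟨b.1 • t, hmem _ b.2⟩ from Subtype.ext e]
      · exact (induce_adj.2 hadj).reachable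
  have ht0 : t ∈ {w | chart htr C w - chart htr C t ∈ box 2 ℓ} := by
    show chart htr C t - chart htr C t ∈ box 2 ℓ
    rw [sub_self]; exact zero_mem_box 2 ℓ
  have h1 : (1 : A) ∈ {a : A | C.ψ a - C.ψ 1 ∈ box 2 ℓ} := by
    show C.ψ 1 - C.ψ 1 ∈ box 2 ℓ
    rw [sub_self]; exact zero_mem_box 2 ℓ
  have hsec' : ∀ w : V, chart htr C w - chart htr C t ∈ box 2 ℓ → C.ψ (sec htr w) - C.ψ 1 ∈ box 2 ℓ := by
    intro w hw
    rw [chart_base, sub_zero] at hw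
    rw [C.ψ_one, sub_zero]
    exact hw
  have hsec : ∀ u : {w | chart htr C w - chart htr C t ∈ box 2 ℓ}, sec htr u.1 ∈ {a : A | C.ψ a - C.ψ 1 ∈ box 2 ℓ} :=
    fun u => hsec' u.1 u.2
  refine (connected_iff _).2 ⟨fun u v => ?_, ⟨⟨t, ht0⟩⟩⟩
  obtain ⟨p⟩ := hcay.preconnected ⟨1, h1⟩ ⟨sec htr u.1, hsec u⟩
  obtain ⟨q⟩ := hcay.preconnected ⟨1, h1⟩ ⟨sec htr v.1, hsec v⟩
  have ru := key _ _ p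
  have rv := key _ _ q
  have eu : (⟨sec htr u.1 • t, hmem _ (hsec u)⟩ : {w | chart htr C w - chart htr C t ∈ box 2 ℓ}) = u := Subtype.ext (sec_smul htr u.1)
  have ev : (⟨sec htr v.1 • t, hmem _ (hsec v)⟩ : {w | chart htr C w - chart htr C t ∈ box 2 ℓ}) = v := Subtype.ext (sec_smul htr v.1)
  rw [eu] at ru
  rw [ev] at rv
  exact ru.symm.trans rv

/-- **THE ONE-TYPE SCALED SKELETON OF `G`** from the Cayley datum on `(A, S_A)`: chart `ψ ∘ sec`, `L = N`, frames `a • ·`, base vertex `t`, exact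
`N`-steps `b • t ↦ (b tᵢ^{±1}) • t`, cylinders connected from `ℓ₀` on. [cite: KozmaNitzan2024, §4 p. 16 (Lemma 8)] [cite: MartineauTassion2017, §3.2] -/
def skeleton : PlanarSkeletonFrmScaled G where
  φ := chart htr C
  L := C.N
  lip := by
    intro u v huv i
    obtain ⟨b, rfl⟩ := htr u
    have hadj : G.Adj t (b⁻¹ • v) := by
      have h := (hact b⁻¹ (b • t) v).2 huv
      rwa [inv_smul_smul] at h
    obtain ⟨a, ha⟩ := htr (b⁻¹ • v)
    have hs : a ∈ genSet G t hfin := mem_genSet.2 (Or.inr (by rw [ha]; exact hadj))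
    have hv : v = (b * a) • t := by rw [mul_smul, ha, smul_inv_smul]
    rw [hv, chart_smul_base, chart_smul_base, C.ψ_mul, Pi.add_apply, sub_add_cancel_left, abs_neg]
    exact C.abs_ψ_le hs i
  types := {t}
  frame := fun v => ⟨t, Finset.mem_singleton_self t, smulIso hact (sec htr v), sec_smul htr v, fun w => by
    rw [smulIso_apply, chart_smul, chart_base, sub_zero]
    unfold chart
    rw [add_comm]⟩
  Δ := G.degree t
  degree_le := fun v => by
    obtain ⟨a, rfl⟩ := htr v
    rw [← smulIso_apply hact a t, Iso.degree_eq]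
  N := C.N
  one_le_N := C.one_le_N
  step := fun v i σ => by
    obtain ⟨b, rfl⟩ := htr v
    rcases Int.units_eq_one_or σ with rfl | rfl
    · refine ⟨(b * C.gen' i) • t, ?_, ?_⟩
      · rw [mul_smul]; exact (hact b _ _).2 (adj_gen C i)
      · rw [chart_smul_base, chart_smul_base, C.ψ_mul, C.ψ_gen', Units.val_one, mul_one]
    · refine ⟨(b * (C.gen' i)⁻¹) • t, ?_, ?_⟩
      · rw [mul_smul]
        refine (hact b _ _).2 ?_
        have h := (hact (C.gen' i)⁻¹ _ _).2 (adj_gen C i)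
        rw [inv_smul_smul] at h
        exact h.symm
      · rw [chart_smul_base, chart_smul_base, C.ψ_mul, C.ψ_inv, C.ψ_gen', Units.val_neg, Units.val_one, mul_neg, mul_one,
          Pi.single_neg]
  ℓ₀ := C.ℓ₀
  cyl_connected := fun t' ht' ℓ hℓ => by
    rw [Finset.mem_singleton] at ht'
    subst ht'
    exact cyl_connected hact htr C hℓ

/-- The skeleton has the single base vertex `t`. [folklore] -/
theorem skeleton_types : (skeleton hact htr C).types = {t} := rfl

end Skeleton

/-! ## §4 The theorem -/

omit [G.LocallyFinite] in
/-- `G` is quasi-transitive under a transitive action by automorphisms. [cite: BenjaminiSchramm1996, §2 (almost transitive graphs)] -/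
theorem isQuasiTransitive_of_action (hact : IsActionByAut G A) {t : V} (htr : ∀ v : V, ∃ a : A, a • t = v) : IsQuasiTransitive G :=
  ⟨{t}, fun v => by
    obtain ⟨a, rfl⟩ := htr v
    exact ⟨smulIso hact a⁻¹, by rw [smulIso_apply, inv_smul_smul]; exact Finset.mem_singleton_self t⟩⟩

/-- **THEOREM (modulo the scaled node ALONE) — the chart-free INPUT(G) for vertex-transitive graphs**: `G` connected and locally finite, `A` acting
on `V(G)` by automorphisms, transitively, with finite stabiliser of `t`, and a homomorphism `c : A → ℤ²` of rank-2 image (`b₁(A) ≥ 2`) ⟹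
`θ_v(p_c(G)) = 0` at every vertex.  Exponential growth of `Cay(A; S_A)` passes to `G` (Hutchcroft); otherwise Milnor's lemma + `CayleyScaled.ofKerFG`
give the datum on `(A, S_A)` and `G` carries the one-type scaled skeleton `skeleton`. [cite: BenjaminiSchramm1996, Conj. 4; §2]
[cite: Hutchcroft2016, Thm. 1.1] [cite: MilnorSolvableGrowth1968, Lemma 1] -/
theorem criticalContinuity (hN : SamePDropOfSkeletonFrmScaled₁) (hact : IsActionByAut G A) (hc : G.Connected) (t : V)
    (htr : ∀ v : V, ∃ a : A, a • t = v) (hfin : (MulAction.stabilizer A t : Set A).Finite) (c : A →* Multiplicative (Site 2))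
    (hrank : ∃ a b : A, MaxArea.det2 (Multiplicative.toAdd (c a)) (Multiplicative.toAdd (c b)) ≠ 0) (v : V) :
    theta G v (criticalProbIOf G v) = 0 := by
  by_cases hexp : HasExponentialGrowth (mulCayley (↑(genSet G t hfin) : Set A))
  · exact Hutchcroft2016_noPercolationAtCriticality_holds G hc (isQuasiTransitive_of_action hact htr)
      (hasExponentialGrowth_of_cayley hact htr hfin hexp) v
  · have hS := closure_genSet hact hc htr hfin
    exact continuity_of_frmScaledNode₁_ray hN G
      (skeleton hact htr (CayleyScaled.ofKerFG c hrank (Milnor.ker_fg_of_not_hasExponentialGrowth _ hS hexp c) (genSet G t hfin) hS))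
      t (Finset.mem_singleton_self t) rfl v

/-- … and `θ_v(p) = 0` for every `p ≤ p_c`. [cite: BenjaminiSchramm1996, Conj. 4; §2] -/
theorem theta_eq_zero_of_le (hN : SamePDropOfSkeletonFrmScaled₁) (hact : IsActionByAut G A) (hc : G.Connected) (t : V)
    (htr : ∀ v : V, ∃ a : A, a • t = v) (hfin : (MulAction.stabilizer A t : Set A).Finite) (c : A →* Multiplicative (Site 2))
    (hrank : ∃ a b : A, MaxArea.det2 (Multiplicative.toAdd (c a)) (Multiplicative.toAdd (c b)) ≠ 0) (v : V) {p : unitInterval}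
    (hp : (p : ℝ) ≤ criticalProb G v) : theta G v p = 0 := by
  haveI : Countable V := countable_of_connected_of_locallyFinite G hc t
  rcases hp.lt_or_eq with hlt | heq
  · exact theta_eq_zero_of_lt_criticalProb_holds G v p hlt
  · have e : p = criticalProbIOf G v := Subtype.ext heq
    rw [e]
    exact criticalContinuity hN hact hc t htr hfin c hrank v

end AutScaled

end Summit.CriticalPhenomena.PercolationContinuityZ3.Theorems.Transplant

end
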